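/-
Copyright (c) 2026 the pub-hodgecm-mathlib formalisation cell (harness21).  Prover seat hodgecm-mathlib-LH4-p14 (g2), req620 Track A «(D-RAM) FOUR-FRAME» squad
(unit U3_Laws, MS ROAD A Stage B; brick B10 PART 2 «BOX RE-INDEX» dealt by the Stage-B lead LH4-p10 (g2) 2026-09-04T00:09:27Z; MS ledger LH4-p11 (g2); dealer LH4-plan (g11)).  2026-09-04.
-/
import Summits.HodgeConjecture.HodgeConjecture.Theorems.F0P3cDyRamStableCountBoxReindexPlanes   -- B10 PART 2 FILE 2 (this seat): `sum_box_mul_eq`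
import HarnessLib

/-!
# Crux `H413`, line LH4 «(D-RAM) FOUR-FRAME» road — unit U3_Laws (iii), MS ROAD A Stage B, brick B10 PART 2 «BOX RE-INDEX», FILE 3∕3: THE TWO STAGE-B INSTANCES —
# the type-0 and the type-2 SKELETON stub tables VERBATIM ⇒ `(q − 1)·Σ_{a : Fin 3 → Fin (B+1)} v a = q^k − 1`

Cell `hodgecm-mathlib` (D-0151), FLOOR 0, crux item H413 = `stmt-HodgeConjecture-24833`, route of record `HCCMUnconditional`; squad F0∕P3c∕LH4 (req618∕req620).  THEOREMS ONLY;
lane `--supports stmt-HodgeConjecture-24833 --as helper` (count-neutral).  The hypotheses of the two heads are, token for token with `(Fintype.card 𝓀[K] : ℚ) ↦ (q : ℚ)`, the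
right-hand sides of LH4-p10 (g2)'s B10 SKELETON v1 stubs (`F0/P3c/LH4/LH4-p10/g2/B10-StableCountType{Zero,Two}.SKELETON.v1.LH4p10g2.lean`: `stub_B4_core∕T1`, `stub_P_T2∕T3`,
`stub_B56_G1`, `stub_P_G2∕G3`, `stub_B7_H`) read as values of `v := fun a => ∑ᶠ M ∈ stratum σ ϖ T a, stabiliserWeight σ M`, and `hzero` is the B3-γ ∕ B3₂-γ shape list (`stub_B3_shapes`:
`v a = 0` off the list because the stratum is empty).  So B10 ∕ B10₂ = ★ PART 1 (`finsum_mem_eq_sum_box_finsum_mem_hasAxis`) + the stubs + THIS head: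
* `sum_box_mul_eq_typeZero` — `ρ ≥ 1`, `r = 2ρ`, `2 ∣ s`; core `v(0,0,0) = 1`;
* `sum_box_mul_eq_typeTwo` — `ρ ≥ 0`, `r = 2ρ + 1`, on-branch `¬ 2 ∣ s`, tube exponent `2ρ + s/2`, the glue clauses with the extra `2ρ+1 ≤ 2n′`, hanging `(q−2)q^{2ρ}`; NO core
  (`v(0,0,0) = 0` follows from `hzero`).
HONEST LABEL.  Count-neutral (`--supports`); finite-sum bookkeeping, nothing printed is asserted; (MS) stays a PROVER TARGET until B10 ⊕ B10₂ ⊕ (O2c) land; `HC_CM` is proved only modulo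
the 7 printed citations (2 remaining named inputs: hLiu418 = `stmt-HodgeConjecture-24832`, h413 = `stmt-HodgeConjecture-24833`) until rung 0 closes.

## References
* [Rogawski1990] J. D. Rogawski, *Automorphic Representations of Unitary Groups in Three Variables*, Ann. of Math. Stud. 123 (1990), §4.9 Prop. 4.9.1 (a) p. 55.
* [Kottwitz1986BaseChangeUnits] R. E. Kottwitz, *Base change for unit elements of Hecke algebras*, Compositio Math. 60 (1986), §1 pp. 240–241.
-/

set_option autoImplicit false

namespace Summit.HodgeConjecture.HodgeConjecture.Cruxes.H413.F0P3cDyRamStableCountBoxReindexTypes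

open Finset
open Summit.HodgeConjecture.HodgeConjecture.Cruxes.H413.F0P3cDyRamStableCountBoxReindex
open Summit.HodgeConjecture.HodgeConjecture.Cruxes.H413.F0P3cDyRamStableCountBoxReindexPlanes

/-! ## §6  The two Stage-B instances: the type-0 and the type-2 skeleton tables VERBATIM -/

/-- **B10 PART 2 «BOX RE-INDEX», TYPE 0** (LH4-p10 (g2) B10 SKELETON v1 `F0/P3c/LH4/LH4-p10/g2/B10-StableCountTypeZero.SKELETON.v1.LH4p10g2.lean`, stub right-hand sides
VERBATIM with `(Fintype.card 𝓀 : ℚ) ↦ (q : ℚ)`; `hzero` = the B3-γ shape list): `(q − 1)·Σ_{a : Fin 3 → Fin (B+1)} v a = q^k − 1`, `2k + d = n₁ + n₂ + n₃ + 2`.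
[cite: Rogawski1990, §4.9 Prop. 4.9.1 (a) p. 55] -/
theorem sum_box_mul_eq_typeZero (q : ℕ) {d n₁ n₂ n₃ B k : ℕ} (hd : 1 ≤ d)
    (hiso : (n₁ = n₂ ∧ n₁ ≤ n₃) ∨ (n₁ = n₃ ∧ n₁ ≤ n₂) ∨ (n₂ = n₃ ∧ n₂ ≤ n₁))
    (hdn : d ≤ min n₁ (min n₂ n₃)) (h1 : n₁ % 2 = d % 2) (h2 : n₂ % 2 = d % 2) (h3 : n₃ % 2 = d % 2) (hB : n₁ + n₂ + n₃ ≤ B)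
    (hk : 2 * k + d = n₁ + n₂ + n₃ + 2) (v : (Fin 3 → ℕ) → ℚ)
    (hcore : v ![0, 0, 0] = 1)
    (hT1 : ∀ s, 1 ≤ s → v ![0, s, s] = if 2 ∣ s ∧ s ≤ n₁ then (q : ℚ) ^ (s / 2) else 0)
    (hT2 : ∀ s, 1 ≤ s → v ![s, 0, s] = if 2 ∣ s ∧ s ≤ n₂ then (q : ℚ) ^ (s / 2) else 0)
    (hT3 : ∀ s, 1 ≤ s → v ![s, s, 0] = if 2 ∣ s ∧ s ≤ n₃ then (q : ℚ) ^ (s / 2) else 0)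
    (hG1 : ∀ ρ s, 1 ≤ ρ → 1 ≤ s → v ![2 * ρ, 2 * ρ + s, 2 * ρ + s] =
      (if 2 ∣ s ∧ 2 * ρ ≤ min n₂ n₃ ∧ 2 * ρ + s ≤ n₁ then ((q : ℚ) - 1) * (q : ℚ) ^ (2 * ρ + s / 2 - 1) else 0) +
      (if 2 ∣ s ∧ n₂ = n₃ ∧ n₁ = n₂ + s ∧ n₂ < 2 * ρ ∧ 2 * ρ - n₂ ≤ n₂ - d + 1
        then (q : ℚ) ^ (2 * ρ + s / 2 - (2 * ρ - n₂ + 1) / 2) else 0))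
    (hG2 : ∀ ρ s, 1 ≤ ρ → 1 ≤ s → v ![2 * ρ + s, 2 * ρ, 2 * ρ + s] =
      (if 2 ∣ s ∧ 2 * ρ ≤ min n₁ n₃ ∧ 2 * ρ + s ≤ n₂ then ((q : ℚ) - 1) * (q : ℚ) ^ (2 * ρ + s / 2 - 1) else 0) +
      (if 2 ∣ s ∧ n₁ = n₃ ∧ n₂ = n₁ + s ∧ n₁ < 2 * ρ ∧ 2 * ρ - n₁ ≤ n₁ - d + 1
        then (q : ℚ) ^ (2 * ρ + s / 2 - (2 * ρ - n₁ + 1) / 2) else 0))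
    (hG3 : ∀ ρ s, 1 ≤ ρ → 1 ≤ s → v ![2 * ρ + s, 2 * ρ + s, 2 * ρ] =
      (if 2 ∣ s ∧ 2 * ρ ≤ min n₁ n₂ ∧ 2 * ρ + s ≤ n₃ then ((q : ℚ) - 1) * (q : ℚ) ^ (2 * ρ + s / 2 - 1) else 0) +
      (if 2 ∣ s ∧ n₁ = n₂ ∧ n₃ = n₁ + s ∧ n₁ < 2 * ρ ∧ 2 * ρ - n₁ ≤ n₁ - d + 1
        then (q : ℚ) ^ (2 * ρ + s / 2 - (2 * ρ - n₁ + 1) / 2) else 0))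
    (hH : ∀ ρ, 1 ≤ ρ → v ![2 * ρ, 2 * ρ, 2 * ρ] =
      (if 2 * ρ ≤ min n₁ (min n₂ n₃) then ((q : ℚ) - 2) * (q : ℚ) ^ (2 * ρ - 1) else 0) +
      (if n₁ = n₂ ∧ n₂ = n₃ ∧ n₁ < 2 * ρ ∧ 2 * ρ - n₁ ≤ n₁ - d + 1 then (q : ℚ) ^ (2 * ρ - (2 * ρ - n₁ + 1) / 2) else 0))
    (hzero : ∀ a : Fin 3 → ℕ, ¬ ((a = ![0, 0, 0]) ∨
      (∃ s, 2 ∣ s ∧ 2 ≤ s ∧ (a = ![0, s, s] ∨ a = ![s, 0, s] ∨ a = ![s, s, 0])) ∨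
      (∃ ρ s, 1 ≤ ρ ∧ 2 ∣ s ∧ 2 ≤ s ∧ (a = ![2 * ρ, 2 * ρ + s, 2 * ρ + s] ∨ a = ![2 * ρ + s, 2 * ρ, 2 * ρ + s] ∨ a = ![2 * ρ + s, 2 * ρ + s, 2 * ρ])) ∨
      (∃ ρ, 1 ≤ ρ ∧ a = ![2 * ρ, 2 * ρ, 2 * ρ])) → v a = 0) :
    ((q : ℚ) - 1) * ∑ a : Fin 3 → Fin (B + 1), v (fun i => (a i : ℕ)) = (q : ℚ) ^ k - 1 := by
  refine sum_box_mul_eq q 0 (Nat.zero_le 1) hd hiso hdn h1 h2 h3 hB hk v (by rw [if_pos rfl]; exact hcore) ?_ ?_ ?_ ?_ ?_ ?_ ?_ ?_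
  · intro s hs; rw [hT1 s hs]; simp only [Nat.dvd_iff_mod_eq_zero]
  · intro s hs; rw [hT2 s hs]; simp only [Nat.dvd_iff_mod_eq_zero]
  · intro s hs; rw [hT3 s hs]; simp only [Nat.dvd_iff_mod_eq_zero]
  · intro r s hr hr0 hs
    obtain ⟨ρ, rfl⟩ : ∃ ρ, r = 2 * ρ := ⟨r / 2, by omega⟩
    rw [hG1 ρ s (by omega) hs]; simp only [Nat.dvd_iff_mod_eq_zero]
  · intro r s hr hr0 hs
    obtain ⟨ρ, rfl⟩ : ∃ ρ, r = 2 * ρ := ⟨r / 2, by omega⟩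
    rw [hG2 ρ s (by omega) hs]; simp only [Nat.dvd_iff_mod_eq_zero]
  · intro r s hr hr0 hs
    obtain ⟨ρ, rfl⟩ : ∃ ρ, r = 2 * ρ := ⟨r / 2, by omega⟩
    rw [hG3 ρ s (by omega) hs]; simp only [Nat.dvd_iff_mod_eq_zero]
  · intro r hr hr0
    obtain ⟨ρ, rfl⟩ : ∃ ρ, r = 2 * ρ := ⟨r / 2, by omega⟩
    rw [hH ρ (by omega)]
  · intro a ha
    have hshape := not_imp_comm.1 (hzero a) ha
    rcases hshape with h | ⟨s, hs2, hs2', h⟩ | ⟨ρ, s, hρ, hs2, hs2', h⟩ | ⟨ρ, hρ, h⟩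
    · exact Or.inl h
    · exact Or.inr (Or.inl ⟨s, by omega, h⟩)
    · exact Or.inr (Or.inr (Or.inl ⟨2 * ρ, s, by omega, by omega, by omega, h⟩))
    · exact Or.inr (Or.inr (Or.inr ⟨2 * ρ, by omega, by omega, h⟩))

/-- **B10₂ PART 2 «BOX RE-INDEX», TYPE 2** (LH4-p10 (g2) B10₂ SKELETON v1 `…/B10-StableCountTypeTwo.SKELETON.v1.LH4p10g2.lean`, stub right-hand sides VERBATIM, `ρ ≥ 0`,
`hzero` = the B3₂-γ shape list; no core): `(q − 1)·Σ_{a} v a = q^k − 1`. [cite: Rogawski1990, §4.9 Prop. 4.9.1 (a) p. 55] -/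
theorem sum_box_mul_eq_typeTwo (q : ℕ) {d n₁ n₂ n₃ B k : ℕ} (hd : 1 ≤ d)
    (hiso : (n₁ = n₂ ∧ n₁ ≤ n₃) ∨ (n₁ = n₃ ∧ n₁ ≤ n₂) ∨ (n₂ = n₃ ∧ n₂ ≤ n₁))
    (hdn : d ≤ min n₁ (min n₂ n₃)) (h1 : n₁ % 2 = d % 2) (h2 : n₂ % 2 = d % 2) (h3 : n₃ % 2 = d % 2) (hB : n₁ + n₂ + n₃ ≤ B)
    (hk : 2 * k + d = n₁ + n₂ + n₃ + 2) (v : (Fin 3 → ℕ) → ℚ)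
    (hT1 : ∀ s, 1 ≤ s → v ![0, s, s] = if ¬ 2 ∣ s ∧ s ≤ n₁ then (q : ℚ) ^ (s / 2) else 0)
    (hT2 : ∀ s, 1 ≤ s → v ![s, 0, s] = if ¬ 2 ∣ s ∧ s ≤ n₂ then (q : ℚ) ^ (s / 2) else 0)
    (hT3 : ∀ s, 1 ≤ s → v ![s, s, 0] = if ¬ 2 ∣ s ∧ s ≤ n₃ then (q : ℚ) ^ (s / 2) else 0)
    (hG1 : ∀ ρ s, 1 ≤ s → v ![2 * ρ + 1, 2 * ρ + 1 + s, 2 * ρ + 1 + s] =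
      (if 2 ∣ s ∧ 2 * ρ + 1 ≤ min n₂ n₃ ∧ 2 * ρ + 1 + s ≤ n₁ then ((q : ℚ) - 1) * (q : ℚ) ^ (2 * ρ + s / 2) else 0) +
      (if 2 ∣ s ∧ n₂ = n₃ ∧ n₁ = n₂ + s ∧ n₂ < 2 * ρ + 1 ∧ 2 * ρ + 1 ≤ 2 * n₂ ∧ 2 * ρ + 1 - n₂ ≤ n₂ - d + 1
        then (q : ℚ) ^ (2 * ρ + 1 + s / 2 - (2 * ρ + 1 - n₂ + 1) / 2) else 0))
    (hG2 : ∀ ρ s, 1 ≤ s → v ![2 * ρ + 1 + s, 2 * ρ + 1, 2 * ρ + 1 + s] =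
      (if 2 ∣ s ∧ 2 * ρ + 1 ≤ min n₁ n₃ ∧ 2 * ρ + 1 + s ≤ n₂ then ((q : ℚ) - 1) * (q : ℚ) ^ (2 * ρ + s / 2) else 0) +
      (if 2 ∣ s ∧ n₁ = n₃ ∧ n₂ = n₁ + s ∧ n₁ < 2 * ρ + 1 ∧ 2 * ρ + 1 ≤ 2 * n₁ ∧ 2 * ρ + 1 - n₁ ≤ n₁ - d + 1
        then (q : ℚ) ^ (2 * ρ + 1 + s / 2 - (2 * ρ + 1 - n₁ + 1) / 2) else 0))
    (hG3 : ∀ ρ s, 1 ≤ s → v ![2 * ρ + 1 + s, 2 * ρ + 1 + s, 2 * ρ + 1] =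
      (if 2 ∣ s ∧ 2 * ρ + 1 ≤ min n₁ n₂ ∧ 2 * ρ + 1 + s ≤ n₃ then ((q : ℚ) - 1) * (q : ℚ) ^ (2 * ρ + s / 2) else 0) +
      (if 2 ∣ s ∧ n₁ = n₂ ∧ n₃ = n₁ + s ∧ n₁ < 2 * ρ + 1 ∧ 2 * ρ + 1 ≤ 2 * n₁ ∧ 2 * ρ + 1 - n₁ ≤ n₁ - d + 1
        then (q : ℚ) ^ (2 * ρ + 1 + s / 2 - (2 * ρ + 1 - n₁ + 1) / 2) else 0))
    (hH : ∀ ρ, v ![2 * ρ + 1, 2 * ρ + 1, 2 * ρ + 1] =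
      (if 2 * ρ + 1 ≤ min n₁ (min n₂ n₃) then ((q : ℚ) - 2) * (q : ℚ) ^ (2 * ρ) else 0) +
      (if n₁ = n₂ ∧ n₂ = n₃ ∧ n₁ < 2 * ρ + 1 ∧ 2 * ρ + 1 ≤ 2 * n₁ ∧ 2 * ρ + 1 - n₁ ≤ n₁ - d + 1
        then (q : ℚ) ^ (2 * ρ + 1 - (2 * ρ + 1 - n₁ + 1) / 2) else 0))
    (hzero : ∀ a : Fin 3 → ℕ, ¬ ((∃ s, ¬ 2 ∣ s ∧ (a = ![0, s, s] ∨ a = ![s, 0, s] ∨ a = ![s, s, 0])) ∨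
      (∃ ρ s, 2 ∣ s ∧ 2 ≤ s ∧ (a = ![2 * ρ + 1, 2 * ρ + 1 + s, 2 * ρ + 1 + s] ∨ a = ![2 * ρ + 1 + s, 2 * ρ + 1, 2 * ρ + 1 + s] ∨
        a = ![2 * ρ + 1 + s, 2 * ρ + 1 + s, 2 * ρ + 1])) ∨
      (∃ ρ, a = ![2 * ρ + 1, 2 * ρ + 1, 2 * ρ + 1])) → v a = 0) :
    ((q : ℚ) - 1) * ∑ a : Fin 3 → Fin (B + 1), v (fun i => (a i : ℕ)) = (q : ℚ) ^ k - 1 := by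
  have hm₁ : min n₁ (min n₂ n₃) ≤ n₁ := min_le_left _ _
  have hm₂ : min n₁ (min n₂ n₃) ≤ n₂ := le_trans (min_le_right _ _) (min_le_left _ _)
  refine sum_box_mul_eq q 1 le_rfl hd hiso hdn h1 h2 h3 hB hk v ?_ ?_ ?_ ?_ ?_ ?_ ?_ ?_ ?_
  · rw [if_neg one_ne_zero]
    apply hzero
    rintro (⟨s, hs, h | h | h⟩ | ⟨ρ, s, -, -, h | h | h⟩ | ⟨ρ, h⟩) <;> rw [vec3_eq_iff] at h <;> omega
  · intro s hs; rw [hT1 s hs]; simp only [Nat.two_dvd_ne_zero]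
  · intro s hs; rw [hT2 s hs]; simp only [Nat.two_dvd_ne_zero]
  · intro s hs; rw [hT3 s hs]; simp only [Nat.two_dvd_ne_zero]
  · intro r s hr hr1 hs
    obtain ⟨ρ, rfl⟩ : ∃ ρ, r = 2 * ρ + 1 := ⟨r / 2, by omega⟩
    rw [hG1 ρ s hs, show 2 * ρ + 1 + s / 2 - 1 = 2 * ρ + s / 2 by omega]
    simp only [Nat.dvd_iff_mod_eq_zero]
    congr 1
    split_ifs <;> first | rfl | (exfalso; omega)
  · intro r s hr hr1 hs
    obtain ⟨ρ, rfl⟩ : ∃ ρ, r = 2 * ρ + 1 := ⟨r / 2, by omega⟩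
    rw [hG2 ρ s hs, show 2 * ρ + 1 + s / 2 - 1 = 2 * ρ + s / 2 by omega]
    simp only [Nat.dvd_iff_mod_eq_zero]
    congr 1
    split_ifs <;> first | rfl | (exfalso; omega)
  · intro r s hr hr1 hs
    obtain ⟨ρ, rfl⟩ : ∃ ρ, r = 2 * ρ + 1 := ⟨r / 2, by omega⟩
    rw [hG3 ρ s hs, show 2 * ρ + 1 + s / 2 - 1 = 2 * ρ + s / 2 by omega]
    simp only [Nat.dvd_iff_mod_eq_zero]
    congr 1
    split_ifs <;> first | rfl | (exfalso; omega)
  · intro r hr hr1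
    obtain ⟨ρ, rfl⟩ : ∃ ρ, r = 2 * ρ + 1 := ⟨r / 2, by omega⟩
    rw [hH ρ, Nat.add_sub_cancel]
    congr 1
    split_ifs <;> first | rfl | (exfalso; omega)
  · intro a ha
    have hshape := not_imp_comm.1 (hzero a) ha
    rcases hshape with ⟨s, hs2, h⟩ | ⟨ρ, s, hs2, hs2', h⟩ | ⟨ρ, h⟩
    · exact Or.inr (Or.inl ⟨s, by omega, h⟩)
    · exact Or.inr (Or.inr (Or.inl ⟨2 * ρ + 1, s, by omega, by omega, by omega, h⟩))
    · exact Or.inr (Or.inr (Or.inr ⟨2 * ρ + 1, by omega, by omega, h⟩))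

end Summit.HodgeConjecture.HodgeConjecture.Cruxes.H413.F0P3cDyRamStableCountBoxReindexTypes
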